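import Literature.NumberTheory.EllipticCurves.KugaSatoLevelTwist
import HarnessLib

/-!
# The `N`-torsion subscheme `E[N]` of a group scheme and level structures

Topic: `Literature/NumberTheory/EllipticCurves`. First object on the existence side of
`nonempty_kugaSatoVariety` (`KugaSatoVariety.lean`): a full level-`N` structure on an elliptic
curve `E → S` is, in Deligne's formulation, an isomorphism `α : E_N ⥲ (ℤ/N)²_S` with the KERNEL
`E_N` OF MULTIPLICATION BY `N` (Deligne, Sém. Bourbaki 355, (3.6): "courbes elliptiques munies d'un
isomorphisme `α : E_n → (ℤ/n)²`"; Katz–Mazur (3.1), and Thm. 2.3.1 for `E[N]` finite étale when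
`N` is invertible), whereas the tree's `EllCurveOver.LevelStructure` records the two sections
`P, Q` directly. This file constructs `E[N]` for any `S`-group scheme `E` (a group object of
`Over S`) and relates the two formulations at the level of points:

* `KugaSato.mulBy E N : E ⟶ E` — multiplication by `N` (the `N`-th power of `𝟙 E` in the group
  `Hom(E, E)`), with `comp_mulBy : P ≫ [N] = P ^ N`;
* `KugaSato.torsion E N = E[N]` — the fibre of `[N]` over the unit section (a pullback in
  `Over S`), its inclusion `torsionι : E[N] ⟶ E` (a monomorphism, `[N]`-trivial:
  `torsionι_pow`), and the **universal property** `torsionPointsEquiv :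
  (T ⟶ E[N]) ≃ {P : T ⟶ E // P ^ N = 1}` — `E[N]` represents the `N`-torsion points
  (`torsionLift`, `torsionLift_ι`, `torsion_hom_ext`);
* for a level structure `φ`: the basis sections factor through `E[N]`
  (`LevelStructure.PTors`, `QTors`, and `sectionTors hc ab` for `φ(a, b) = P^a Q^b` when `P`, `Q`
  commute — automatic on an elliptic curve; `N`-torsion by `section_pow_eq_one` of
  `KugaSatoLevelTwist`).

Nothing here uses that `E` is an elliptic curve; finiteness, flatness and étaleness of `E[N]`
(Katz–Mazur Thm. 2.3.1) are NOT asserted. All proved; no named facts.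

## References

* P. Deligne, *Formes modulaires et représentations ℓ-adiques*, Sém. Bourbaki 355 (1969), (3.6).
  [Deligne1971Bourbaki355]
* N. Katz, B. Mazur, *Arithmetic moduli of elliptic curves* (1985), (3.1), Thm. 2.3.1.
  [KatzMazur1985]
-/

universe u

open CategoryTheory Limits AlgebraicGeometry MonoidalCategory CartesianMonoidalCategory
open scoped MonObj

noncomputable section

namespace Literature.NumberTheory.EllipticCurves

namespace KugaSato

variable {S : Scheme.{u}} (E : Over S) [GrpObj E]

/-! ### Multiplication by `N` -/

/-- **Multiplication by `N`**, `[N] : E ⟶ E`, on an `S`-group scheme (written multiplicatively: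
the `N`-th power of the identity in the group `Hom(E, E)`; the map whose kernel is Deligne's `E_n`
of (3.6)). [cite: Deligne1971Bourbaki355, (3.6)] -/
def mulBy (N : ℕ) : E ⟶ E :=
  (𝟙 E) ^ N

/-- On points, `[N]` is the `N`-th power: `P ≫ [N] = P ^ N`. [folklore] -/
theorem comp_mulBy {T : Over S} (P : T ⟶ E) (N : ℕ) : P ≫ mulBy E N = P ^ N := by
  rw [mulBy, MonObj.comp_pow, Category.comp_id]

/-- `[0] = 1` (the constant map to the unit). [folklore] -/
@[simp]
theorem mulBy_zero : mulBy E 0 = 1 :=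
  pow_zero _

/-- `[1] = 𝟙`. [folklore] -/
@[simp]
theorem mulBy_one : mulBy E 1 = 𝟙 E :=
  pow_one _

/-- `[N + 1] = [N] · 𝟙`. [folklore] -/
theorem mulBy_succ (N : ℕ) : mulBy E (N + 1) = mulBy E N * 𝟙 E :=
  pow_succ _ _

/-! ### The `N`-torsion subscheme `E[N]` -/

/-- **The `N`-torsion subscheme `E[N]`** of an `S`-group scheme: the fibre of `[N] : E ⟶ E` over
the unit section `η : S ⟶ E`, i.e. the pullback `E ×_{[N], E, η} S` in `Over S` (Deligne (3.6):
the group scheme `E_n` of `n`-torsion, source of the level structure `α : E_n → (ℤ/n)²`;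
Katz–Mazur (3.1)). [cite: Deligne1971Bourbaki355, (3.6)] -/
abbrev torsion (N : ℕ) : Over S :=
  pullback (mulBy E N) η[E]

/-- The inclusion `E[N] ⟶ E`. [cite: Deligne1971Bourbaki355, (3.6)] -/
abbrev torsionι (N : ℕ) : torsion E N ⟶ E :=
  pullback.fst (mulBy E N) η[E]

/-- `E[N]` is killed by `[N]`: `ι ≫ [N] = 1`. [folklore] -/
theorem torsionι_comp_mulBy (N : ℕ) : torsionι E N ≫ mulBy E N = 1 := by
  rw [pullback.condition, Hom.one_def, toUnit_unique (pullback.snd _ _) (toUnit _)]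

/-- `ι ^ N = 1` in `Hom(E[N], E)`. [folklore] -/
theorem torsionι_pow (N : ℕ) : torsionι E N ^ N = 1 := by
  rw [← comp_mulBy, torsionι_comp_mulBy]

/-- The unit section is a split monomorphism (retraction: the map to the terminal object).
[folklore] -/
theorem isSplitMono_one : IsSplitMono (η[E] : 𝟙_ (Over S) ⟶ E) :=
  IsSplitMono.mk' ⟨toUnit E, toUnit_unique _ _⟩

/-- `E[N] ⟶ E` is a monomorphism (base change of the unit section). [folklore] -/
instance mono_torsionι (N : ℕ) : Mono (torsionι E N) := by
  haveI := isSplitMono_one E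
  exact pullback.fst_of_mono

/-- **Lift an `N`-torsion point to `E[N]`**: a `T`-point `P` of `E` with `P ^ N = 1` factors
through `E[N]`. [folklore] -/
def torsionLift {T : Over S} (N : ℕ) (P : T ⟶ E) (hP : P ^ N = 1) : T ⟶ torsion E N :=
  pullback.lift P (toUnit T) (by rw [comp_mulBy, hP, Hom.one_def])

/-- The lift composed with the inclusion is the given point. [folklore] -/
@[reassoc (attr := simp)]
theorem torsionLift_ι {T : Over S} (N : ℕ) (P : T ⟶ E) (hP : P ^ N = 1) :
    torsionLift E N P hP ≫ torsionι E N = P :=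
  pullback.lift_fst _ _ _

/-- Two points of `E[N]` agree iff they agree in `E`. [folklore] -/
theorem torsion_hom_ext {T : Over S} {N : ℕ} {f g : T ⟶ torsion E N}
    (h : f ≫ torsionι E N = g ≫ torsionι E N) : f = g :=
  (cancel_mono (torsionι E N)).mp h

/-- A point of `E[N]` is `N`-torsion in `E`. [folklore] -/
theorem comp_torsionι_pow {T : Over S} (N : ℕ) (f : T ⟶ torsion E N) :
    (f ≫ torsionι E N) ^ N = 1 := by
  rw [← MonObj.comp_pow, torsionι_pow, MonObj.comp_one]

/-- **`E[N]` represents the `N`-torsion points**: for every `S`-scheme `T`,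
`E[N](T) ≃ {P ∈ E(T) | P ^ N = 1}` (Deligne (3.6); Katz–Mazur (3.1)).
[cite: Deligne1971Bourbaki355, (3.6)] -/
def torsionPointsEquiv (T : Over S) (N : ℕ) :
    (T ⟶ torsion E N) ≃ {P : T ⟶ E // P ^ N = 1} where
  toFun f := ⟨f ≫ torsionι E N, comp_torsionι_pow E N f⟩
  invFun P := torsionLift E N P.1 P.2
  left_inv _ := torsion_hom_ext E (torsionLift_ι E N _ _)
  right_inv _ := Subtype.ext (torsionLift_ι E N _ _)

/-- Unfolding of `torsionPointsEquiv`. [folklore] -/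
@[simp]
theorem torsionPointsEquiv_apply_coe (T : Over S) (N : ℕ) (f : T ⟶ torsion E N) :
    ((torsionPointsEquiv E T N f : {P : T ⟶ E // P ^ N = 1}) : T ⟶ E) = f ≫ torsionι E N :=
  rfl

/-- The unit section of `E` factors through `E[N]` (the unit of `E[N]`). [folklore] -/
def torsionOne (N : ℕ) : 𝟙_ (Over S) ⟶ torsion E N :=
  torsionLift E N 1 (one_pow N)

/-- `torsionOne ≫ ι = η`. [folklore] -/
@[simp]
theorem torsionOne_ι (N : ℕ) : torsionOne E N ≫ torsionι E N = 1 :=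
  torsionLift_ι E N _ _

end KugaSato

/-! ### Level structures and `E[N]` -/

namespace EllCurveOver.LevelStructure

variable {S : Scheme.{u}} {C : EllCurveOver S} {N : ℕ} (φ : LevelStructure N C)

/-- The first basis section as a section of `E[N]` (it is `N`-torsion, `pow_P`).
[cite: Deligne1971Bourbaki355, (3.6)] -/
def PTors : 𝟙_ (Over S) ⟶ KugaSato.torsion C.E N :=
  KugaSato.torsionLift C.E N φ.P φ.pow_P

/-- The second basis section as a section of `E[N]`. [cite: Deligne1971Bourbaki355, (3.6)] -/
def QTors : 𝟙_ (Over S) ⟶ KugaSato.torsion C.E N :=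
  KugaSato.torsionLift C.E N φ.Q φ.pow_Q

/-- `PTors ≫ ι = P`. [folklore] -/
@[simp]
theorem PTors_ι : φ.PTors ≫ KugaSato.torsionι C.E N = φ.P :=
  KugaSato.torsionLift_ι C.E N _ _

/-- `QTors ≫ ι = Q`. [folklore] -/
@[simp]
theorem QTors_ι : φ.QTors ≫ KugaSato.torsionι C.E N = φ.Q :=
  KugaSato.torsionLift_ι C.E N _ _

/-- The section `φ(a, b)` as a section of `E[N]` (for commuting `P`, `Q`; it is `N`-torsion by
`section_pow_eq_one` of `KugaSatoLevelTwist`). [cite: Deligne1971Bourbaki355, (3.7)] -/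
def sectionTors (hc : Commute φ.P φ.Q) (ab : ZMod N × ZMod N) :
    𝟙_ (Over S) ⟶ KugaSato.torsion C.E N :=
  KugaSato.torsionLift C.E N (φ.section_ ab) (φ.section_pow_eq_one hc ab)

/-- `sectionTors ≫ ι = section_`. [folklore] -/
@[simp]
theorem sectionTors_ι (hc : Commute φ.P φ.Q) (ab : ZMod N × ZMod N) :
    φ.sectionTors hc ab ≫ KugaSato.torsionι C.E N = φ.section_ ab :=
  KugaSato.torsionLift_ι C.E N _ _

/-- On every geometric fibre the `N²` sections `φ(a, b)` of `E[N]` are pairwise distinct (the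
basis condition of the level structure, read in `E[N]`). [cite: Deligne1971Bourbaki355, (3.6)] -/
theorem sectionTors_injective (hc : Commute φ.P φ.Q) ⦃Ω : Type u⦄ [Field Ω] [IsAlgClosed Ω]
    (s : Spec (.of Ω) ⟶ S) :
    Function.Injective fun ab : ZMod N × ZMod N =>
      toUnit (Over.mk s) ≫ φ.sectionTors hc ab := by
  intro ab ab' h
  apply φ.basis_injective s
  have h' := congrArg (· ≫ KugaSato.torsionι C.E N) h
  simp only [Category.assoc, sectionTors_ι, section_] at h'
  exact h'

end EllCurveOver.LevelStructure

end Literature.NumberTheory.EllipticCurves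

end
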